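import Literature.Analysis.FluidPDE.Ferrari1993H3BoundRegularity
import Mathlib.Analysis.Calculus.FDeriv.Symmetric
import HarnessLib

/-!
# Iterated directional derivatives: the word expansion of the Sobolev norm of a smooth function,
and iterated spatial derivatives of jointly smooth time-dependent fields

Topic `Literature/Analysis/FluidPDE`. Calculus toolkit for the `D^α`-energy method of
Ferrari 1993 ((8)–(13), p. 280) in the smooth periodic class `IsPeriodicCylinderEulerSolution`
(fields `C^∞` jointly in `(t, x)` on `S × K`, `K` the closed cylinder), used by
`Ferrari1993EnergyInequalityReduction.lean`. Two groups of folklore statements.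

1. **Words of directions.** `iterDeriv m v f = ∂_{v (m-1)} ⋯ ∂_{v 0} f` is the iterated classical
   directional derivative of `f : E → F` along a word `v : Fin m → E` (junk where `f` is not
   differentiable). On an open set where `f` is `C^∞` it is local (`iterDeriv_congr_of_isOpen`),
   smooth (`ContDiffOn.iterDeriv_of_isOpen`) and additive (`iterDeriv_add_of_isOpen`, `_neg_`,
   `_sub_`). **Word expansion of the tree's Sobolev norm**
   (`eSobolevDomainNorm_eq_sum_iterDeriv`): for `f` smooth on the open set `Ω`,
   `‖f‖_{W^{k,p}(Ω)} = Σ_{m ≤ k} Σ_{w : Fin m → ι} ‖iterDeriv m (e ∘ w) f‖_{L^p(Ω)}`, `(eᵢ)_{i : ι}` the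
   basis `Module.finBasis ℝ E` of the norm's definition — by induction on `k`, the infimum in
   `‖f‖_{W^{k+1,p}} = ‖f‖_{L^p} + inf_g Σᵢ ‖g eᵢ‖_{W^{k,p}}` being attained at the classical derivative
   (`MeyersSerrin.eSobolevDomainNorm_succ_eq`, `MeyersSerrin.hasWeakFDerivOn_of_contDiffOn`) and the
   words of length `m + 1` being `cons i w` (`Fin.consEquiv`).
2. **Joint fields.** For `G : ℝ → X → F` jointly `C^∞` on `S × K` (`S`, `K` of unique
   differentiability), `jointIterDeriv S K m v G` iterates the spatial components
   `(t, x) ↦ D(t, x)(0, v)` of the joint derivative `D = fderivWithin (uncurry G) (S × K)`; it is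
   again jointly `C^∞` on `S × K` (`contDiffOn_uncurry_jointIterDeriv`), agrees at interior points
   of `K` with the classical iterated derivative of the slice
   (`jointIterDeriv_apply_eq_iterDeriv`), inherits spatial periods of `G`
   (`jointIterDeriv_add_period`), and — the point of the construction — **its time derivative is
   the iterated derivative of the time derivative** at interior points of `S × K`
   (`timeDerivWithin_jointIterDeriv`: symmetry of second derivatives of `C^∞` functions,
   `ContDiffAt.isSymmSndFDerivAt`, iterated).

Mathlib/tree search: Mathlib has `iteratedFDeriv` (multilinear, all directions at once) and
`iteratedDeriv` (one variable) but no derivative along a word of fixed directions, which is the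
form matching the recursive sum in `eSobolevDomainNorm`; the tree has the one-step versions
`contDiffOn_uncurry_fderivWithin_apply`, `fderiv_slice_apply_eq` (`Ferrari1993H3BoundRegularity`)
and `fderiv_slice_of_contDiffOn`, `timeDerivWithin_eq_fderivWithin_uncurry`
(`SpaceTimeSliceCalculus`), iterated here. Used from Mathlib: `ContDiffAt.isSymmSndFDerivAt`,
`fderiv_clm_apply`, `fderivWithin_comp_add_right`, `Fin.consEquiv`, `Fintype.sum_equiv`,
`Fintype.sum_prod_type'`, `Finset.sum_range_succ'`, `contDiffOn_infty_iff_fderiv_of_isOpen`.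
-/

noncomputable section

open MeasureTheory Set Function Filter Topology TopologicalSpace
open scoped ContDiff NNReal ENNReal Pointwise

namespace Literature.Analysis.FluidPDE

open Literature.Analysis.FunctionSpaces

/-! ### Iterated directional derivatives along a word of directions -/

section IterDeriv

variable {E : Type*} [NormedAddCommGroup E] [NormedSpace ℝ E]
variable {F : Type*} [NormedAddCommGroup F] [NormedSpace ℝ F]

/-- **Iterated directional derivative along a word**: `iterDeriv m v f = ∂_{v (m-1)} ⋯ ∂_{v 0} f`,
the classical directional derivatives `∂_e f (x) = Df(x) e` applied in the order `v 0` first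
(junk value wherever `fderiv` is junk). For `v` ranging over words in a basis these are the
`D^α f` of the multi-index calculus, ordered (Evans, *PDE*, App. A notation `D^α`; the ordered
form matches the recursion of `Literature.Analysis.FunctionSpaces.eSobolevDomainNorm`). [folklore] -/
def iterDeriv : (m : ℕ) → (Fin m → E) → (E → F) → (E → F)
  | 0, _, f => f
  | m + 1, v, f => iterDeriv m (Fin.tail v) (fun x => fderiv ℝ f x (v 0))

/-- The empty word does nothing. [folklore] -/
@[simp]
theorem iterDeriv_zero (v : Fin 0 → E) (f : E → F) : iterDeriv 0 v f = f := rfl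

/-- One more letter: differentiate along `v 0` first, then along the tail. [folklore] -/
theorem iterDeriv_succ (m : ℕ) (v : Fin (m + 1) → E) (f : E → F) :
    iterDeriv (m + 1) v f = iterDeriv m (Fin.tail v) (fun x => fderiv ℝ f x (v 0)) := rfl

/-- **Locality**: functions equal on an open set have equal iterated derivatives there. [folklore] -/
theorem iterDeriv_congr_of_isOpen {U : Set E} (hU : IsOpen U) :
    ∀ (m : ℕ) (v : Fin m → E) {f g : E → F}, EqOn f g U →
      EqOn (iterDeriv m v f) (iterDeriv m v g) U
  | 0, _, _, _, h => h
  | m + 1, v, f, g, h => by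
    rw [iterDeriv_succ, iterDeriv_succ]
    refine iterDeriv_congr_of_isOpen hU m (Fin.tail v) fun x hx => ?_
    have hfg : f =ᶠ[𝓝 x] g := eventuallyEq_of_mem (hU.mem_nhds hx) h
    simp only [hfg.fderiv_eq]

/-- The components `x ↦ Df(x) e` of the derivative of a function `C^∞` on an open set are `C^∞`
there. [folklore] -/
theorem contDiffOn_fderiv_apply_of_isOpen {U : Set E} (hU : IsOpen U) {f : E → F}
    (hf : ContDiffOn ℝ ∞ f U) (e : E) : ContDiffOn ℝ ∞ (fun x => fderiv ℝ f x e) U :=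
  ((contDiffOn_infty_iff_fderiv_of_isOpen hU).1 hf).2.clm_apply contDiffOn_const

/-- **Smoothness**: iterated derivatives of a function `C^∞` on an open set are `C^∞` there.
[folklore] -/
theorem ContDiffOn.iterDeriv_of_isOpen {U : Set E} (hU : IsOpen U) :
    ∀ (m : ℕ) (v : Fin m → E) {f : E → F}, ContDiffOn ℝ ∞ f U →
      ContDiffOn ℝ ∞ (iterDeriv m v f) U
  | 0, _, _, h => h
  | m + 1, v, _, h => by
    rw [iterDeriv_succ]
    exact ContDiffOn.iterDeriv_of_isOpen hU m _ (contDiffOn_fderiv_apply_of_isOpen hU h (v 0))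

/-- A function `C^∞` on an open set is differentiable at its points. [folklore] -/
theorem differentiableAt_of_contDiffOn_isOpen {U : Set E} (hU : IsOpen U) {f : E → F}
    (hf : ContDiffOn ℝ ∞ f U) {x : E} (hx : x ∈ U) : DifferentiableAt ℝ f x :=
  (hf.differentiableOn (by simp) x hx).differentiableAt (hU.mem_nhds hx)

/-- **Additivity** on an open set where both functions are `C^∞`. [folklore] -/
theorem iterDeriv_add_of_isOpen {U : Set E} (hU : IsOpen U) :
    ∀ (m : ℕ) (v : Fin m → E) {f g : E → F}, ContDiffOn ℝ ∞ f U → ContDiffOn ℝ ∞ g U →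
      EqOn (iterDeriv m v (fun x => f x + g x)) (fun x => iterDeriv m v f x + iterDeriv m v g x) U
  | 0, _, _, _, _, _ => fun _ _ => rfl
  | m + 1, v, f, g, hf, hg => by
    intro x hx
    rw [iterDeriv_succ, iterDeriv_succ, iterDeriv_succ]
    have h1 : EqOn (fun y => fderiv ℝ (fun x => f x + g x) y (v 0))
        (fun y => fderiv ℝ f y (v 0) + fderiv ℝ g y (v 0)) U := fun y hy => by
      simp only [fderiv_fun_add (differentiableAt_of_contDiffOn_isOpen hU hf hy)
        (differentiableAt_of_contDiffOn_isOpen hU hg hy), FunLike.coe_add, Pi.add_apply]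
    rw [iterDeriv_congr_of_isOpen hU m (Fin.tail v) h1 hx]
    exact iterDeriv_add_of_isOpen hU m (Fin.tail v) (contDiffOn_fderiv_apply_of_isOpen hU hf (v 0))
      (contDiffOn_fderiv_apply_of_isOpen hU hg (v 0)) hx

/-- **Negation** commutes with iterated derivatives on an open set of smoothness. [folklore] -/
theorem iterDeriv_neg_of_isOpen {U : Set E} (hU : IsOpen U) :
    ∀ (m : ℕ) (v : Fin m → E) {f : E → F}, ContDiffOn ℝ ∞ f U →
      EqOn (iterDeriv m v (fun x => -f x)) (fun x => -iterDeriv m v f x) U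
  | 0, _, _, _ => fun _ _ => rfl
  | m + 1, v, f, hf => by
    intro x hx
    rw [iterDeriv_succ, iterDeriv_succ]
    have h1 : EqOn (fun y => fderiv ℝ (fun x => -f x) y (v 0))
        (fun y => -fderiv ℝ f y (v 0)) U := fun y _ => by
      simp only [fderiv_fun_neg, FunLike.coe_neg, Pi.neg_apply]
    rw [iterDeriv_congr_of_isOpen hU m (Fin.tail v) h1 hx]
    exact iterDeriv_neg_of_isOpen hU m (Fin.tail v) (contDiffOn_fderiv_apply_of_isOpen hU hf (v 0)) hx

/-- **Subtraction** on an open set where both functions are `C^∞`. [folklore] -/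
theorem iterDeriv_sub_of_isOpen {U : Set E} (hU : IsOpen U) (m : ℕ) (v : Fin m → E) {f g : E → F}
    (hf : ContDiffOn ℝ ∞ f U) (hg : ContDiffOn ℝ ∞ g U) :
    EqOn (iterDeriv m v (fun x => f x - g x)) (fun x => iterDeriv m v f x - iterDeriv m v g x) U := by
  intro x hx
  have e1 : (fun x => f x - g x) = fun x => f x + -g x := by funext y; exact sub_eq_add_neg _ _
  have h1 := iterDeriv_add_of_isOpen hU m v hf hg.neg hx
  have h2 := iterDeriv_neg_of_isOpen hU m v hg hx
  simp only at h1 h2 ⊢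
  rw [e1, h1, h2, sub_eq_add_neg]

/-- The word `cons a w` first differentiates along `a`: `iterDeriv (m+1) (cons a w) f = iterDeriv m w (∂_a f)`.
[folklore] -/
theorem iterDeriv_cons (m : ℕ) (a : E) (w : Fin m → E) (f : E → F) :
    iterDeriv (m + 1) (Fin.cons a w) f = iterDeriv m w (fun x => fderiv ℝ f x a) := by
  rw [iterDeriv_succ, Fin.tail_cons, Fin.cons_zero]

/-- Words in an indexed family of directions: `iterDeriv (m+1) (b ∘ cons i w) f = iterDeriv m (b ∘ w) (∂_{b i} f)`.
[folklore] -/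
theorem iterDeriv_comp_cons {ι : Type*} (b : ι → E) (m : ℕ) (i : ι) (w : Fin m → ι) (f : E → F) :
    iterDeriv (m + 1) (fun j => b ((Fin.cons i w : Fin (m + 1) → ι) j)) f =
      iterDeriv m (fun j => b (w j)) (fun x => fderiv ℝ f x (b i)) := by
  rw [iterDeriv_succ]
  have htail : Fin.tail (fun j => b ((Fin.cons i w : Fin (m + 1) → ι) j)) = fun j => b (w j) := by
    funext j
    simp [Fin.tail]
  rw [htail]
  simp only [Fin.cons_zero]

end IterDeriv

/-! ### The word expansion of the Sobolev norm of a smooth function -/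

section Expansion

variable {E : Type*} [NormedAddCommGroup E] [NormedSpace ℝ E] [FiniteDimensional ℝ E]
  [MeasurableSpace E] [BorelSpace E] {μ : Measure E} [μ.IsAddHaarMeasure]
variable {F : Type*} [NormedAddCommGroup F] [NormedSpace ℝ F] [CompleteSpace F]

/-- A sum over the words of length `0` has one term. [folklore] -/
theorem sum_fin_zero_fun {ι M : Type*} [Fintype ι] [AddCommMonoid M] (g : (Fin 0 → ι) → M) :
    ∑ w : Fin 0 → ι, g w = g Fin.elim0 := by
  haveI : Unique (Fin 0 → ι) := Pi.uniqueOfIsEmpty _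
  rw [Fintype.sum_unique]
  exact congrArg g (Subsingleton.elim _ _)

/-- A sum over the words of length `m + 1`, letter by letter: `w = cons i w'`. [folklore] -/
theorem sum_fin_succ_fun {ι M : Type*} [Fintype ι] [AddCommMonoid M] (m : ℕ)
    (g : (Fin (m + 1) → ι) → M) :
    ∑ w : Fin (m + 1) → ι, g w = ∑ i : ι, ∑ w : Fin m → ι, g (Fin.cons i w) := by
  rw [← Fintype.sum_prod_type']
  exact Fintype.sum_equiv (Fin.consEquiv fun _ => ι).symm _ _ fun w => by
    show g w = g (Fin.cons (w 0) (Fin.tail w))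
    rw [Fin.cons_self_tail]

/-- **Word expansion of the Sobolev norm of a smooth function**: for `f` of class `C^∞` on the open
set `Ω`, the tree's norm `‖f‖_{W^{k,p}(Ω)}` (sum form, through weak derivatives, along the basis
`e = Module.finBasis ℝ E`) equals the finite sum over all words `w` of length `m ≤ k` in the basis
of the `L^p(Ω)` norms of the classical iterated derivatives `iterDeriv m (e ∘ w) f`
(Brezis, *Functional Analysis*, §9.1: `‖u‖_{W^{k,p}} = Σ_{|α| ≤ k} ‖D^α u‖_{L^p}`, here over ordered
multi-indices). Induction on `k`: the infimum over weak derivatives is attained at the classical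
derivative (`MeyersSerrin.eSobolevDomainNorm_succ_eq` with `MeyersSerrin.hasWeakFDerivOn_of_contDiffOn`),
and words of length `m + 1` are `cons i w` (`Fin.consEquiv`). [folklore] -/
theorem eSobolevDomainNorm_eq_sum_iterDeriv {Ω : Opens E} (p : ℝ≥0∞) :
    ∀ (k : ℕ) {f : E → F}, ContDiffOn ℝ ∞ f Ω →
      eSobolevDomainNorm k p Ω μ f =
        ∑ m ∈ Finset.range (k + 1), ∑ w : Fin m → Fin (Module.finrank ℝ E),
          eLpNorm (iterDeriv m (fun j => Module.finBasis ℝ E (w j)) f) p (μ.restrict Ω)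
  | 0, f, _ => by
    rw [eSobolevDomainNorm_zero, Finset.sum_range_one, sum_fin_zero_fun]
    rfl
  | k + 1, f, hf => by
    rw [MeyersSerrin.eSobolevDomainNorm_succ_eq (p := p) (k := k)
      (MeyersSerrin.hasWeakFDerivOn_of_contDiffOn (μ := μ) hf), Finset.sum_range_succ',
      sum_fin_zero_fun, iterDeriv_zero, add_comm]
    congr 1
    -- the words of positive length, letter by letter
    have hIH : ∀ i : Fin (Module.finrank ℝ E),
        eSobolevDomainNorm k p Ω μ (fun x => fderiv ℝ f x (Module.finBasis ℝ E i)) =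
        ∑ m ∈ Finset.range (k + 1), ∑ w : Fin m → Fin (Module.finrank ℝ E),
          eLpNorm (iterDeriv m (fun j => Module.finBasis ℝ E (w j))
            (fun x => fderiv ℝ f x (Module.finBasis ℝ E i))) p (μ.restrict Ω) :=
      fun i => eSobolevDomainNorm_eq_sum_iterDeriv p k
        (contDiffOn_fderiv_apply_of_isOpen Ω.isOpen hf (Module.finBasis ℝ E i))
    simp only [hIH]
    rw [Finset.sum_comm]
    refine Finset.sum_congr rfl fun m _ => ?_
    rw [sum_fin_succ_fun]
    refine Finset.sum_congr rfl fun i _ => Finset.sum_congr rfl fun w _ => ?_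
    rw [iterDeriv_comp_cons ⇑(Module.finBasis ℝ E)]

end Expansion

/-! ### Iterated spatial derivatives of jointly smooth time-dependent fields -/

section Joint

variable {X : Type*} [NormedAddCommGroup X] [NormedSpace ℝ X]
variable {F : Type*} [NormedAddCommGroup F] [NormedSpace ℝ F]

/-- The spatial directional derivative of a time-dependent field read off the joint derivative
within `S × K`: `spaceDerivWithin S K v G (t, x) = D(uncurry G)|_{S × K}(t, x)(0, v)`. [folklore] -/
def spaceDerivWithin (S : Set ℝ) (K : Set X) (v : X) (G : ℝ → X → F) : ℝ → X → F :=
  fun t x => fderivWithin ℝ (uncurry G) (S ×ˢ K) (t, x) ((0 : ℝ), v)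

/-- Unfolding `spaceDerivWithin`. [folklore] -/
theorem spaceDerivWithin_apply (S : Set ℝ) (K : Set X) (v : X) (G : ℝ → X → F) (t : ℝ) (x : X) :
    spaceDerivWithin S K v G t x = fderivWithin ℝ (uncurry G) (S ×ˢ K) (t, x) ((0 : ℝ), v) := rfl

/-- **Iterated spatial derivatives of a jointly smooth field along a word** `v : Fin m → X`,
through the joint derivative within `S × K` at each step (so that joint smoothness up to the
boundary is preserved): `jointIterDeriv S K (m+1) v G = jointIterDeriv S K m (tail v) (∂_{v 0} G)`.
[folklore] -/
def jointIterDeriv (S : Set ℝ) (K : Set X) : (m : ℕ) → (Fin m → X) → (ℝ → X → F) → (ℝ → X → F)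
  | 0, _, G => G
  | m + 1, v, G => jointIterDeriv S K m (Fin.tail v) (spaceDerivWithin S K (v 0) G)

/-- The empty word does nothing. [folklore] -/
@[simp]
theorem jointIterDeriv_zero (S : Set ℝ) (K : Set X) (v : Fin 0 → X) (G : ℝ → X → F) :
    jointIterDeriv S K 0 v G = G := rfl

/-- One more letter. [folklore] -/
theorem jointIterDeriv_succ (S : Set ℝ) (K : Set X) (m : ℕ) (v : Fin (m + 1) → X) (G : ℝ → X → F) :
    jointIterDeriv S K (m + 1) v G = jointIterDeriv S K m (Fin.tail v) (spaceDerivWithin S K (v 0) G) :=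
  rfl

variable {S : Set ℝ} {K : Set X}

/-- One spatial derivative within `S × K` of a jointly `C^∞` field is jointly `C^∞` on `S × K`
(`S`, `K` of unique differentiability). [folklore] -/
theorem contDiffOn_uncurry_spaceDerivWithin (hS : UniqueDiffOn ℝ S) (hK : UniqueDiffOn ℝ K)
    {G : ℝ → X → F} (hG : ContDiffOn ℝ ∞ (uncurry G) (S ×ˢ K)) (v : X) :
    ContDiffOn ℝ ∞ (uncurry (spaceDerivWithin S K v G)) (S ×ˢ K) := by
  have hD : ContDiffOn ℝ ∞ (fun z => fderivWithin ℝ (uncurry G) (S ×ˢ K) z) (S ×ˢ K) :=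
    hG.fderivWithin (hS.prod hK) (by simp)
  refine (hD.clm_apply contDiffOn_const (g := fun _ => ((0 : ℝ), v))).congr ?_
  rintro ⟨t, x⟩ _
  rfl

/-- **Joint smoothness is preserved**: `jointIterDeriv S K m v G` is jointly `C^∞` on `S × K` if `G`
is. [folklore] -/
theorem contDiffOn_uncurry_jointIterDeriv (hS : UniqueDiffOn ℝ S) (hK : UniqueDiffOn ℝ K) :
    ∀ (m : ℕ) (v : Fin m → X) {G : ℝ → X → F}, ContDiffOn ℝ ∞ (uncurry G) (S ×ˢ K) →
      ContDiffOn ℝ ∞ (uncurry (jointIterDeriv S K m v G)) (S ×ˢ K)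
  | 0, _, _, h => h
  | m + 1, v, _, h => by
    rw [jointIterDeriv_succ]
    exact contDiffOn_uncurry_jointIterDeriv hS hK m _ (contDiffOn_uncurry_spaceDerivWithin hS hK h (v 0))

/-- At interior points of `K` the spatial derivative within `S × K` is the classical derivative of
the slice: `spaceDerivWithin S K v G t x = D(G t)(x) v` for `t ∈ S`, `K ∈ 𝓝 x`. [folklore] -/
theorem spaceDerivWithin_apply_eq_fderiv {G : ℝ → X → F} {n : WithTop ℕ∞}
    (hG : ContDiffOn ℝ n (uncurry G) (S ×ˢ K)) (hn : n ≠ 0) {t : ℝ} (ht : t ∈ S) {x : X}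
    (hxK : x ∈ K) (hKx : K ∈ 𝓝 x) (v : X) :
    spaceDerivWithin S K v G t x = fderiv ℝ (G t) x v := by
  rw [spaceDerivWithin_apply, fderiv_slice_of_contDiffOn hG hn ht hxK hKx]
  rfl

/-- **Interior agreement with the classical iterated derivative of the slice**: for `t ∈ S` and `x`
in an open set `U ⊆ K`, `jointIterDeriv S K m v G t x = iterDeriv m v (G t) x`. [folklore] -/
theorem jointIterDeriv_apply_eq_iterDeriv (hS : UniqueDiffOn ℝ S) (hK : UniqueDiffOn ℝ K)
    {U : Set X} (hU : IsOpen U) (hUK : U ⊆ K) :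
    ∀ (m : ℕ) (v : Fin m → X) {G : ℝ → X → F}, ContDiffOn ℝ ∞ (uncurry G) (S ×ˢ K) →
      ∀ {t : ℝ}, t ∈ S → EqOn (jointIterDeriv S K m v G t) (iterDeriv m v (G t)) U
  | 0, _, _, _, _, _ => fun _ _ => rfl
  | m + 1, v, G, hG, t, ht => by
    intro x hx
    rw [jointIterDeriv_succ, iterDeriv_succ]
    have h1 : EqOn (spaceDerivWithin S K (v 0) G t) (fun y => fderiv ℝ (G t) y (v 0)) U :=
      fun y hy => spaceDerivWithin_apply_eq_fderiv hG (by simp) ht (hUK hy)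
        (mem_of_superset (hU.mem_nhds hy) hUK) (v 0)
    rw [jointIterDeriv_apply_eq_iterDeriv hS hK hU hUK m (Fin.tail v)
      (contDiffOn_uncurry_spaceDerivWithin hS hK hG (v 0)) ht hx]
    exact iterDeriv_congr_of_isOpen hU m (Fin.tail v) h1 hx

/-- **Spatial periods are inherited by the spatial derivative within `S × K`**: if `K` is invariant
under the translation by `a` and every slice `G t`, `t ∈ S`, is `a`-periodic, then so is every
slice of `spaceDerivWithin S K v G` (translation invariance of `fderivWithin`,
`fderivWithin_comp_add_right`, the translate of `S × K` by `(0, a)` being `S × K`). [folklore] -/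
theorem spaceDerivWithin_add_period {G : ℝ → X → F} {a : X} (hKa : ∀ x, x + a ∈ K ↔ x ∈ K)
    (hG : ∀ t ∈ S, ∀ x, G t (x + a) = G t x) {t : ℝ} (ht : t ∈ S) (v : X) (x : X) :
    spaceDerivWithin S K v G t (x + a) = spaceDerivWithin S K v G t x := by
  simp only [spaceDerivWithin_apply]
  have hper : ∀ z : ℝ × X, z.1 ∈ S → uncurry G (z + ((0 : ℝ), a)) = uncurry G z := by
    rintro ⟨s, y⟩ hs
    simp [hG s hs y]
  have hvadd : ((((0 : ℝ), a) : ℝ × X) +ᵥ (S ×ˢ K) : Set (ℝ × X)) = S ×ˢ K := by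
    ext ⟨s, y⟩
    rw [Set.mem_vadd_set]
    constructor
    · rintro ⟨⟨s', y'⟩, ⟨hs', hy'⟩, h⟩
      have h1 : s' = s := by simpa using congrArg Prod.fst h
      have h2 : a + y' = y := by simpa using congrArg Prod.snd h
      refine ⟨by simpa [← h1] using hs', ?_⟩
      rw [← h2, add_comm]
      exact (hKa y').2 hy'
    · rintro ⟨hs, hy⟩
      refine ⟨(s, y + -a), ⟨hs, ?_⟩, ?_⟩
      · have := (hKa (y + -a)).1
        rw [neg_add_cancel_right] at this
        exact this hy
      · show (((0 : ℝ), a) : ℝ × X) +ᵥ ((s, y + -a) : ℝ × X) = (s, y)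
        rw [vadd_eq_add, Prod.mk_add_mk, zero_add, add_comm a, neg_add_cancel_right]
  have key := fderivWithin_comp_add_right (𝕜 := ℝ) (f := uncurry G) (s := S ×ˢ K)
    (x := ((t, x) : ℝ × X)) (((0 : ℝ), a) : ℝ × X)
  rw [hvadd, Prod.mk_add_mk, add_zero] at key
  rw [← key]
  exact congrArg (fun Lz : ℝ × X →L[ℝ] F => Lz ((0 : ℝ), v))
    (fderivWithin_congr (fun z hz => hper z hz.1) (hper (t, x) ht))

/-- **Spatial periods are inherited by `jointIterDeriv`** (induction on the word). [folklore] -/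
theorem jointIterDeriv_add_period {a : X} (hKa : ∀ x, x + a ∈ K ↔ x ∈ K) :
    ∀ (m : ℕ) (v : Fin m → X) {G : ℝ → X → F}, (∀ t ∈ S, ∀ x, G t (x + a) = G t x) →
      ∀ {t : ℝ}, t ∈ S → ∀ x, jointIterDeriv S K m v G t (x + a) = jointIterDeriv S K m v G t x
  | 0, _, _, hG, _, ht => fun x => hG _ ht x
  | m + 1, v, G, hG, t, ht => by
    intro x
    rw [jointIterDeriv_succ]
    exact jointIterDeriv_add_period hKa m (Fin.tail v)
      (fun s hs y => spaceDerivWithin_add_period hKa hG hs (v 0) y) ht x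

/-- **Mixed second directional derivatives of a `C^∞` function commute**:
`∂_p ∂_q Φ (z) = ∂_q ∂_p Φ (z)` at a point of smoothness (`ContDiffAt.isSymmSndFDerivAt`, read
through `fderiv_clm_apply`). [folklore] -/
theorem fderiv_fderiv_apply_comm_of_contDiffAt {E : Type*} [NormedAddCommGroup E] [NormedSpace ℝ E]
    {Φ : E → F} {z : E} (hΦ : ContDiffAt ℝ ∞ Φ z) (p q : E) :
    fderiv ℝ (fun z => fderiv ℝ Φ z q) z p = fderiv ℝ (fun z => fderiv ℝ Φ z p) z q := by
  have hΦ2 : ContDiffAt ℝ 2 Φ z := hΦ.of_le (WithTop.coe_le_coe.mpr le_top)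
  have hd : DifferentiableAt ℝ (fderiv ℝ Φ) z :=
    (hΦ2.fderiv_right (m := 1) le_rfl).differentiableAt one_ne_zero
  have h1 : ∀ r : E, fderiv ℝ (fun z => fderiv ℝ Φ z r) z = (fderiv ℝ (fderiv ℝ Φ) z).flip r := by
    intro r
    rw [fderiv_clm_apply hd (differentiableAt_const r), fderiv_const_apply]
    simp
  rw [h1 q, h1 p, ContinuousLinearMap.flip_apply, ContinuousLinearMap.flip_apply]
  exact hΦ2.isSymmSndFDerivAt (by simp) p q

/-- **The time derivative of a spatial derivative is the spatial derivative of the time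
derivative**, at interior points: for `G` jointly `C^∞` on `S × K`, `t ∈ S` with `S ∈ 𝓝 t` and
`x ∈ K` with `K ∈ 𝓝 x`,
`∂ₜ (spaceDerivWithin S K v G) (t, x) = D(∂ₜ G (t, ·))(x) v` (near `(t, x)` all derivatives within
`S × K` are plain derivatives, and the mixed second derivatives of `uncurry G` commute,
`fderiv_fderiv_apply_comm_of_contDiffAt`). [folklore] -/
theorem timeDerivWithin_spaceDerivWithin (hS : UniqueDiffOn ℝ S) {G : ℝ → X → F}
    (hG : ContDiffOn ℝ ∞ (uncurry G) (S ×ˢ K)) {t : ℝ} (ht : t ∈ S) (hSt : S ∈ 𝓝 t)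
    {x : X} (hxK : x ∈ K) (hKx : K ∈ 𝓝 x) (v : X) :
    timeDerivWithin S (spaceDerivWithin S K v G) t x = fderiv ℝ (timeDerivWithin S G t) x v := by
  set Φ : ℝ × X → F := uncurry G with hΦ_def
  have hz : S ×ˢ K ∈ 𝓝 ((t, x) : ℝ × X) := prod_mem_nhds hSt hKx
  have hΦ : ContDiffAt ℝ ∞ Φ (t, x) := (hG.contDiffWithinAt ⟨ht, hxK⟩).contDiffAt hz
  have hnhds : ∀ᶠ z in 𝓝 ((t, x) : ℝ × X), S ×ˢ K ∈ 𝓝 z := by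
    filter_upwards [interior_mem_nhds.2 hz] with z hz' using mem_interior_iff_mem_nhds.1 hz'
  have hΦ2 : ContDiffAt ℝ 2 Φ (t, x) := hΦ.of_le (WithTop.coe_le_coe.mpr le_top)
  have hD : DifferentiableAt ℝ (fderiv ℝ Φ) (t, x) :=
    (hΦ2.fderiv_right (m := 1) le_rfl).differentiableAt one_ne_zero
  -- Step 1: the time derivative is a plain derivative of `s ↦ ∂_{(0,v)} Φ (s, x)`
  have e1 : timeDerivWithin S (spaceDerivWithin S K v G) t x =
      deriv (fun s => fderiv ℝ Φ (s, x) ((0 : ℝ), v)) t := by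
    rw [timeDerivWithin_apply, derivWithin_of_mem_nhds hSt]
    apply Filter.EventuallyEq.deriv_eq
    have hc : Tendsto (fun s : ℝ => ((s, x) : ℝ × X)) (𝓝 t) (𝓝 (t, x)) :=
      (continuous_id.prodMk continuous_const).continuousAt
    filter_upwards [hc.eventually hnhds] with s hs
    simp only [spaceDerivWithin_apply, hΦ_def, fderivWithin_of_mem_nhds hs]
  -- Step 2: which is `∂_{(1,0)} ∂_{(0,v)} Φ (t, x)`
  have hΨd : DifferentiableAt ℝ (fun z => fderiv ℝ Φ z ((0 : ℝ), v)) (t, x) :=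
    hD.clm_apply (differentiableAt_const _)
  have e2 : deriv (fun s => fderiv ℝ Φ (s, x) ((0 : ℝ), v)) t =
      fderiv ℝ (fun z => fderiv ℝ Φ z ((0 : ℝ), v)) (t, x) ((1 : ℝ), (0 : X)) := by
    have hc : HasDerivAt (fun s : ℝ => ((s, x) : ℝ × X)) ((1 : ℝ), (0 : X)) t :=
      (hasDerivAt_id t).prodMk (hasDerivAt_const t x)
    exact (hΨd.hasFDerivAt.comp_hasDerivAt t hc).deriv
  -- Step 3: commute the two derivatives
  have e3 := fderiv_fderiv_apply_comm_of_contDiffAt hΦ ((1 : ℝ), (0 : X)) ((0 : ℝ), v)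
  -- Step 4: `∂_{(0,v)} Θ (t, x) = D(Θ(t, ·))(x) v` for `Θ = ∂_{(1,0)} Φ`
  have hΘd : DifferentiableAt ℝ (fun z => fderiv ℝ Φ z ((1 : ℝ), (0 : X))) (t, x) :=
    hD.clm_apply (differentiableAt_const _)
  have e4 : fderiv ℝ (fun y => fderiv ℝ Φ (t, y) ((1 : ℝ), (0 : X))) x v =
      fderiv ℝ (fun z => fderiv ℝ Φ z ((1 : ℝ), (0 : X))) (t, x) ((0 : ℝ), v) := by
    have hc : HasFDerivAt (fun y : X => ((t, y) : ℝ × X)) (ContinuousLinearMap.inr ℝ ℝ X) x :=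
      hasFDerivAt_prodMk_right t x
    have hcomp := (hΘd.hasFDerivAt.comp x hc).fderiv
    rw [show (fun y => fderiv ℝ Φ (t, y) ((1 : ℝ), (0 : X))) =
        (fun z => fderiv ℝ Φ z ((1 : ℝ), (0 : X))) ∘ (fun y : X => ((t, y) : ℝ × X)) from rfl, hcomp]
    rfl
  -- Step 5: `Θ(t, ·)` is the time derivative near `x`
  have e5 : (fun y => fderiv ℝ Φ (t, y) ((1 : ℝ), (0 : X))) =ᶠ[𝓝 x] timeDerivWithin S G t := by
    filter_upwards [interior_mem_nhds.2 hKx] with y hy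
    have hyK : y ∈ K := interior_subset hy
    have hy' : S ×ˢ K ∈ 𝓝 ((t, y) : ℝ × X) := prod_mem_nhds hSt (mem_interior_iff_mem_nhds.1 hy)
    rw [timeDerivWithin_eq_fderivWithin_uncurry hG (by simp) hS ht hyK, ← hΦ_def,
      fderivWithin_of_mem_nhds hy']
  rw [e1, e2, e3, ← e4, e5.fderiv_eq]

/-- **The time derivative of an iterated spatial derivative is the iterated spatial derivative of
the time derivative**, at interior times and on an open `U ⊆ K`:
`∂ₜ (jointIterDeriv S K m v G) (t, x) = iterDeriv m v (∂ₜ G (t, ·)) (x)` for `G` jointly `C^∞` on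
`S × K`, `t ∈ S`, `S ∈ 𝓝 t`, `x ∈ U` (induction on the word with
`timeDerivWithin_spaceDerivWithin` and the locality of `iterDeriv`). This is the interchange
`∂ₜ D^α u = D^α ∂ₜ u` behind the `D^α`-energy identity (8) of Ferrari 1993. [folklore] -/
theorem timeDerivWithin_jointIterDeriv (hS : UniqueDiffOn ℝ S) (hK : UniqueDiffOn ℝ K)
    {U : Set X} (hU : IsOpen U) (hUK : U ⊆ K) :
    ∀ (m : ℕ) (v : Fin m → X) {G : ℝ → X → F}, ContDiffOn ℝ ∞ (uncurry G) (S ×ˢ K) →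
      ∀ {t : ℝ}, t ∈ S → S ∈ 𝓝 t →
        EqOn (timeDerivWithin S (jointIterDeriv S K m v G) t)
          (iterDeriv m v (timeDerivWithin S G t)) U
  | 0, _, _, _, _, _, _ => fun _ _ => rfl
  | m + 1, v, G, hG, t, ht, hSt => by
    intro x hx
    rw [jointIterDeriv_succ, iterDeriv_succ]
    have hG₁ := contDiffOn_uncurry_spaceDerivWithin hS hK hG (v 0)
    rw [timeDerivWithin_jointIterDeriv hS hK hU hUK m (Fin.tail v) hG₁ ht hSt hx]
    refine iterDeriv_congr_of_isOpen hU m (Fin.tail v) (fun y hy => ?_) hx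
    exact timeDerivWithin_spaceDerivWithin hS hG ht hSt (hUK hy)
      (mem_of_superset (hU.mem_nhds hy) hUK) (v 0)

end Joint

end Literature.Analysis.FluidPDE
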